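import Literature.MathematicalPhysics.QuantumFieldTheory.Balaban1983to89.Node00.LargeFieldBackgroundMSOfRecord
import Literature.MathematicalPhysics.QuantumFieldTheory.Balaban1983to89.Node00.Record12BgRowCoDiv

/-!
# NODE 00 (definitions of record, R-side ₇, FILE 22) — print's FULL regular space `U_k({Ω_j}, ε₀)` = [6] (1.7) ∧ (1.9) = [15] (2), and the (2.12)
# background `U_k(V)` as a MINIMAL CONFIGURATION OVER IT ([15] (6), Thm 1), of record — the CLASS EDITION

T. Bałaban, *The variational problem and background fields in renormalization group method for lattice gauge theories*, Commun. Math. Phys.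
**102** (1985) 277–309 [Balaban1985Variational] = [15], p. 278 [PDF 2], verbatim: *«The space U_k({Ω_j}, ε₀) of gauge field configurations on Ω₀
was defined in Sect. A of [6] by the conditions |U(∂p) − 1| < ε₀L^{−2j} for p ∈ Ω_j, |(D^{η*}_U ∂U)(b)| < ε₀L^{−2j}(L^jη)^{−1} for b ∈ Ω_j (2) …
We consider the functional A(U) … (5) on the space of gauge field configurations U_k({Ω_j}, ε₀) ∩ 𝔘(𝔅_k, V) (6) … Our problem is to find all
critical orbits of the functional (5). … we will prove that there exists a minimal orbit. Elements of the minimal orbit are called minimal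
configurations»*; Thm 1 p. 279 [PDF 3]: *«for an arbitrary configuration V satisfying (7) with ε₁ ≤ a₁ there exists a minimal orbit in the space
U_k({Ω_j}, B₃ε₁) ∩ 𝔘(𝔅_k, V) (8). This orbit is a unique critical orbit in the space (6) if B₃ε₁ ≤ ε₀ and ε₀ ≤ a₀ … Minimal configurations will
be denoted by U_k(V), or U_k»*; [6] = T. Bałaban, *Spaces of regular gauge field configurations on a lattice and gauge fixing conditions*, Commun.
Math. Phys. **99** (1985) 75–102 [Balaban1985RegularSpaces], p. 77 (1.7) *«|U(∂p) − 1| < α₀L^{−2j} for p ∈ Ω_j, j = 0, 1, …, k»* and (1.9)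
*«|(D^{η*}_U ∂U)(b)| < α₀L^{−2j}(L^jη)^{−1} for b ∈ Ω_j, j = 0, 1, …, k»* (r-tree shape: `B8Ineq132.InAk L k η α Ω V := ∀ j ≤ k, B8Ineq132.CondAt L η α j (Ω j) V`,
whose two conjuncts are (1.7) and (1.9)); T. Bałaban, *Convergent renormalization expansions for lattice gauge theories*, Commun. Math. Phys. **119**
(1988) 243–285 [Balaban1988Convergent] = [III], (2.12) p. 256: *«the functional U ↦ A(U) on U: U regular and M_𝔅(U) = V. (2.12) For precise
definitions and the theory of this variational problem see [15]»*.

HONEST FRAMING (cell `pub-ymgap`, definer seat node00-def-R g14): definitions of record; nothing of Bałaban asserted ([15] Thm 1 existence ∕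
uniqueness, (8)–(10) — NOT asserted: solvability stays the membership `W ∈ solvableDom …` wherever used); counts unmoved; not continuum ∕ OS ∕
mass-gap ∕ Clay.

WHY THIS FILE (director-ym LINE №149 (3), pub-ymgap INBOX l.17673, «TYPE NOW»; HYP-AUDIT-13 row H4 ∕ located №6; referee G DIFFER-143).  FILE 16
`Node00/LargeFieldBackgroundMSOfRecord` types «U regular» of (2.12) as the (1.7)-ONLY class `regMSOfRecord` (the co-divergence clause (1.9) omitted,
divergence D-defB-1) and the background `UbgMSOfRecord` as a minimiser over it.  Print's (2.12) class is [15]'s (6) = [6]'s FULL space (2) = (1.7) ∧ (1.9),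
and [15] Thm 1 proves (1.9)-type regularity only for the critical orbit IN (6): to use the record's `bg` row at its data a consumer would have to show
that the (1.7)-class minimiser satisfies (1.9) — a statement print does not contain (director-ym №149 (1): the `h9` guard of `Record13SepMixed` v1.3
STARVES the K1 lane).  THIS FILE types the class WITH (1.9) and the background as the minimal configuration OVER IT — print's own object `U_k(V)` — so that
(1.9) AT THE MINIMISER is read off the class BY MEMBERSHIP (`coDivClassOn_UbgMSCoOfRecord`, №149 (5)), append-only beside FILE 16 (which stays: landed
modules read it; its objects are the (1.7)-only specialisation).  Director's names `regMSOfRecord′` ∕ `UbgMSOfRecord′` ≡ this file's ASCII tokens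
`regMSCoOfRecord` ∕ `UbgMSCoOfRecord` (a typographic prime is not a token; node00-def-R ONLINE l.17695).

WHAT THIS FILE TYPES.  §1 `regMSCoOfRecord F N ν K k Ω` = `U_k({Ω_j}, εreg)` of [15] (2): FILE 16's (1.7) clauses (`omegaPlaqs`, thresholds `εreg·η_j²`)
AND node00-def-P11's (1.9) clauses `Sect2.CoDivClassOn Ω k εreg` (`Node00/Record12BgRowCoDiv`, thresholds `εreg·η_j³` on `Sect2.omegaBonds Ω j`; the
9b bridge `Sect2.coDivClassOn_iff_regDivAt` identifies them with [B10]'s `RegDivAt` on `unitsField (toUField U)`), with its faces and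
`regMSCoOfRecord ⊆ regMSOfRecord`; §2 the (2.12) datum `bgMSCoOfRecord` and the background of a sequence `UbgMSCoOfRecord F N ν M g K k s` (r11's `Ubg` at
that datum; TOTAL, junk `1` off the solvable set — FILE 1 convention; FILE 1 v2's predicate-fed selector branch applies verbatim, so
`measurable_UminOfRecord_of_selector` serves this class as any other) with its faces — in particular `coDivClassOn_UbgMSCoOfRecord` ((1.9) at the
minimiser) and `plaqSmallOn_UbgMSCoOfRecord` ((1.7) at the minimiser); §3 the junction with FILE 16: a (1.7)-class minimiser that satisfies (1.9)
minimises over the full class (node00-def-P11's `IsMinimizer.of_subset_of_mem`), so FILE 16's background witnesses solvability in this file's class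
whenever it satisfies (1.9) (`mem_solvableDom_regMSCo_of_coDiv`), and the `Γ₀` reading of FILE 16 §4 for this class.

NOT IN THIS FILE (one declarer each): the [15] fact at this class and the row-P11 suppliers (node00-def-P11: `VariationalThm1RegSepPrintedCo` and its
re-key), the Stage-13 record rows (node00-def-T), the selectors (node00-def-K0a∕K0c).  DEPENDENCES: FILE 16 (`regMSOfRecord`, `omegaPlaqs`,
`UbgMSOfRecord`, faces), FILE 1 (`UminOfRecord`, `solvableDom`, `bgOfRecord`, `Stage7Numerics.εreg`), FILE 4 (`SeqOfRecord`), r11 `B14.Eq218Concrete.Ubg`,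
r12 `B15DeterminingSets` (`genSet`, `bondsOf`, `IsMinimizer`, `gammaRegion_zero`), node00-def-P11 `Node00/Record12BgRowCoDiv` (`Sect2.CoDivClassOn`,
`Sect2.CoDivSmallOn`, `Sect2.omegaBonds`, `IsMinimizer.of_subset_of_mem`).  No instance, no notation, no `sorry`.
[cite: Balaban1985Variational, (2),(6) p.278, Thm 1 (8) p.279; Balaban1985RegularSpaces, (1.7),(1.9) p.77; Balaban1988Convergent, (2.12) p.256]
-/

noncomputable section

namespace Literature.MathematicalPhysics.QuantumFieldTheory.Balaban1983to89.Node00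

open Literature.MathematicalPhysics.QuantumFieldTheory.Balaban1983to89
open T4Continuum B15DeterminingSets

variable (F : T4Family) (N : ℕ) [NeZero N]

/-! ## §1  Print's FULL regular space `U_k({Ω_j}, ε₀)` — [15] (2) = [6] (1.7) ∧ (1.9) — of record -/

/-- **PRINT'S FULL REGULARITY CLASS OF (2.12), OF RECORD** — [15] (2) ∕ [6] (1.7) ∧ (1.9) at the letter `α₀ = ε₀ = ν.εreg`:
`U_k({Ω_j}, εreg) = {U | |U(∂p) − 1| < εreg·η_j² for p ∈ Ω_j (1.7) and ‖η·(D^{η*}_U ∂U)(b)‖ < εreg·η_j³ for b ∈ Ω_j (1.9), j = 0, …, k}` (`Ω₀ = T_η`: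
FILE 16 `omegaPlaqs Ω 0 = univ`, node00-def-P11 `Sect2.omegaBonds Ω 0 = univ`).  The first conjunct is FILE 16's `regMSOfRecord` letter for letter, the
second node00-def-P11's `Sect2.CoDivClassOn Ω k ν.εreg` (r-tree shape `B8Ineq132.InAk` = `∀ j ≤ k, CondAt …`, conjuncts (1.7), (1.9)).  Director-ym №149's
`regMSOfRecord′`. [cite: Balaban1985Variational, (2),(6) p.278; Balaban1985RegularSpaces, (1.7),(1.9) p.77; Balaban1988Convergent, (2.12) p.256] -/
def regMSCoOfRecord (ν : Stage7Numerics) (K k : ℕ) (Ω : ℕ → Set (Site (F.P K) 0)) : Set (GaugeField (F.P K) 0 (SU N)) :=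
  {U | (∀ j, j ≤ k → PlaqSmallOn (omegaPlaqs Ω j) (ν.εreg * (F.P K).eta j ^ 2) U) ∧ Sect2.CoDivClassOn Ω k ν.εreg U}

/-- Membership: (1.7)-class membership (FILE 16) AND the (1.9) clauses (definitional). [cite: Balaban1985RegularSpaces, (1.7),(1.9) p.77 (bookkeeping)] -/
theorem mem_regMSCoOfRecord_iff (ν : Stage7Numerics) (K k : ℕ) (Ω : ℕ → Set (Site (F.P K) 0)) (U : GaugeField (F.P K) 0 (SU N)) :
    U ∈ regMSCoOfRecord F N ν K k Ω ↔ U ∈ regMSOfRecord F N ν K k Ω ∧ Sect2.CoDivClassOn Ω k ν.εreg U := Iff.rfl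

/-- The displayed form: both families of clauses spelled out (definitional). [cite: Balaban1985Variational, (2) p.278 (bookkeeping)] -/
theorem regMSCoOfRecord_eq_setOf (ν : Stage7Numerics) (K k : ℕ) (Ω : ℕ → Set (Site (F.P K) 0)) :
    regMSCoOfRecord F N ν K k Ω =
      {U | (∀ j, j ≤ k → PlaqSmallOn (omegaPlaqs Ω j) (ν.εreg * (F.P K).eta j ^ 2) U) ∧ Sect2.CoDivClassOn Ω k ν.εreg U} := rfl

/-- The full class is the (1.7)-class of FILE 16 cut by the (1.9) clauses (definitional). [cite: Balaban1985RegularSpaces, (1.7),(1.9) p.77 (bookkeeping)] -/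
theorem regMSCoOfRecord_eq_inter (ν : Stage7Numerics) (K k : ℕ) (Ω : ℕ → Set (Site (F.P K) 0)) :
    regMSCoOfRecord F N ν K k Ω = regMSOfRecord F N ν K k Ω ∩ {U | Sect2.CoDivClassOn Ω k ν.εreg U} := rfl

variable {F N}

/-- **The full class lies INSIDE FILE 16's (1.7)-only class.** [cite: Balaban1985RegularSpaces, (1.7),(1.9) p.77] -/
theorem regMSCoOfRecord_subset_regMSOfRecord (ν : Stage7Numerics) (K k : ℕ) (Ω : ℕ → Set (Site (F.P K) 0)) :
    regMSCoOfRecord F N ν K k Ω ⊆ regMSOfRecord F N ν K k Ω := fun _ h => h.1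

/-- A member satisfies (1.7) at every scale `j ≤ k` (FILE 16 membership). [cite: Balaban1985RegularSpaces, (1.7) p.77] -/
theorem mem_regMSOfRecord_of_mem_regMSCoOfRecord {ν : Stage7Numerics} {K k : ℕ} {Ω : ℕ → Set (Site (F.P K) 0)} {U : GaugeField (F.P K) 0 (SU N)}
    (hU : U ∈ regMSCoOfRecord F N ν K k Ω) : U ∈ regMSOfRecord F N ν K k Ω := hU.1

/-- A member satisfies the (1.9) clauses (node00-def-P11's `Sect2.CoDivClassOn`). [cite: Balaban1985RegularSpaces, (1.9) p.77] -/
theorem coDivClassOn_of_mem_regMSCoOfRecord {ν : Stage7Numerics} {K k : ℕ} {Ω : ℕ → Set (Site (F.P K) 0)} {U : GaugeField (F.P K) 0 (SU N)}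
    (hU : U ∈ regMSCoOfRecord F N ν K k Ω) : Sect2.CoDivClassOn Ω k ν.εreg U := hU.2

/-- Conversely, (1.7)-class membership and the (1.9) clauses give membership. [cite: Balaban1985RegularSpaces, (1.7),(1.9) p.77 (bookkeeping)] -/
theorem mem_regMSCoOfRecord_of_mem_of_coDivClassOn {ν : Stage7Numerics} {K k : ℕ} {Ω : ℕ → Set (Site (F.P K) 0)} {U : GaugeField (F.P K) 0 (SU N)}
    (h7 : U ∈ regMSOfRecord F N ν K k Ω) (h9 : Sect2.CoDivClassOn Ω k ν.εreg U) : U ∈ regMSCoOfRecord F N ν K k Ω := ⟨h7, h9⟩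

/-- The scale-`0` plaquette clause: a member is GLOBALLY `εreg·η₀²`-small (print's `ε₀` of [15] (6); FILE 16 face). [cite: Balaban1985RegularSpaces, (1.7) p.77 (j = 0)] -/
theorem plaqSmall_of_mem_regMSCoOfRecord {ν : Stage7Numerics} {K k : ℕ} {Ω : ℕ → Set (Site (F.P K) 0)} {U : GaugeField (F.P K) 0 (SU N)}
    (hU : U ∈ regMSCoOfRecord F N ν K k Ω) : PlaqSmall (ν.εreg * (F.P K).eta 0 ^ 2) U :=
  plaqSmall_of_mem_regMSOfRecord hU.1

/-- The scale-`j` plaquette clause, `1 ≤ j ≤ k`: the plaquettes meeting `Ω_j` are `εreg·η_j²`-small (FILE 16 face). [cite: Balaban1985RegularSpaces, (1.7) p.77] -/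
theorem plaqSmallOn_of_mem_regMSCoOfRecord {ν : Stage7Numerics} {K k : ℕ} {Ω : ℕ → Set (Site (F.P K) 0)} {U : GaugeField (F.P K) 0 (SU N)}
    (hU : U ∈ regMSCoOfRecord F N ν K k Ω) {j : ℕ} (hj : 1 ≤ j) (hjk : j ≤ k) :
    PlaqSmallOn (B8Eq17ClassAkV1.plaqsOf (Ω j)) (ν.εreg * (F.P K).eta j ^ 2) U :=
  plaqSmallOn_of_mem_regMSOfRecord hU.1 hj hjk

/-- The scale-`j` co-divergence clause, `j ≤ k`: `‖η·(D^{η*}_U ∂U)(b)‖ < εreg·η_j³` on the bonds of `Sect2.omegaBonds Ω j`.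
[cite: Balaban1985RegularSpaces, (1.9) p.77; Balaban1985Variational, (2) p.278] -/
theorem coDivSmallOn_of_mem_regMSCoOfRecord {ν : Stage7Numerics} {K k : ℕ} {Ω : ℕ → Set (Site (F.P K) 0)} {U : GaugeField (F.P K) 0 (SU N)}
    (hU : U ∈ regMSCoOfRecord F N ν K k Ω) {j : ℕ} (hjk : j ≤ k) :
    Sect2.CoDivSmallOn (Sect2.omegaBonds Ω j) (ν.εreg * (F.P K).eta j ^ 3) U :=
  hU.2 j hjk

/-- The scale-`0` co-divergence clause: on EVERY bond (`Ω₀ = T_η`). [cite: Balaban1985RegularSpaces, (1.9) p.77 (j = 0), (1.3) p.77] -/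
theorem coDivSmallOn_univ_of_mem_regMSCoOfRecord {ν : Stage7Numerics} {K k : ℕ} {Ω : ℕ → Set (Site (F.P K) 0)} {U : GaugeField (F.P K) 0 (SU N)}
    (hU : U ∈ regMSCoOfRecord F N ν K k Ω) : Sect2.CoDivSmallOn Set.univ (ν.εreg * (F.P K).eta 0 ^ 3) U := by
  have h := hU.2 0 (Nat.zero_le k)
  rwa [show Sect2.omegaBonds Ω 0 = (Set.univ : Set (PBond (F.P K) 0)) from if_pos rfl] at h

/-- The scale-`j` co-divergence clause at a positive scale, on r12's `bondsOf (Ω j)` (the bonds with an end-point in `Ω_j`).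
[cite: Balaban1985RegularSpaces, (1.9) p.77, p.77 (convention before (1.5))] -/
theorem coDivSmallOn_bondsOf_of_mem_regMSCoOfRecord {ν : Stage7Numerics} {K k : ℕ} {Ω : ℕ → Set (Site (F.P K) 0)} {U : GaugeField (F.P K) 0 (SU N)}
    (hU : U ∈ regMSCoOfRecord F N ν K k Ω) {j : ℕ} (hj : 1 ≤ j) (hjk : j ≤ k) :
    Sect2.CoDivSmallOn (bondsOf (Ω j)) (ν.εreg * (F.P K).eta j ^ 3) U := by
  have h := hU.2 j hjk
  rwa [show Sect2.omegaBonds Ω j = bondsOf (Ω j) from if_neg (Nat.one_le_iff_ne_zero.mp hj)] at h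

variable (F N)

/-! ## §2  The (2.12) datum and the background of a sequence in print's FULL class, of record -/

/-- **The (2.12) datum of record in print's full class**: FILE 1's `bgOfRecord` along the averaging of record `avOfRecord F N K` in the class
`regMSCoOfRecord … Ω` of the sequence `{Ω_j}`. [cite: Balaban1988Convergent, (2.12)–(2.13) p.256–257; Balaban1985Variational, (6) p.278] -/
def bgMSCoOfRecord (ν : Stage7Numerics) (K k : ℕ) (Ω : ℕ → Set (Site (F.P K) 0)) : DetBackground (F.P K) (SU N) (avOfRecord F N K) :=
  bgOfRecord (avOfRecord F N K) (regMSCoOfRecord F N ν K k Ω)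

/-- Its solution map is FILE 1's `UminOfRecord` in the full class (definitional). [cite: Balaban1988Convergent, (2.12) p.256 (bookkeeping)] -/
theorem bgMSCoOfRecord_U (ν : Stage7Numerics) (K k : ℕ) (Ω : ℕ → Set (Site (F.P K) 0)) :
    (bgMSCoOfRecord F N ν K k Ω).U = UminOfRecord (avOfRecord F N K) (regMSCoOfRecord F N ν K k Ω) := rfl

/-- Its domain is FILE 1's solvable set in the full class (definitional). [cite: Balaban1988Convergent, (2.12) p.256 (bookkeeping)] -/
theorem bgMSCoOfRecord_dom (ν : Stage7Numerics) (K k : ℕ) (Ω : ℕ → Set (Site (F.P K) 0)) :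
    (bgMSCoOfRecord F N ν K k Ω).dom = solvableDom (avOfRecord F N K) (regMSCoOfRecord F N ν K k Ω) := rfl

/-- Its class (definitional). [cite: Balaban1985Variational, (6) p.278 (bookkeeping)] -/
theorem bgMSCoOfRecord_reg (ν : Stage7Numerics) (K k : ℕ) (Ω : ℕ → Set (Site (F.P K) 0)) :
    (bgMSCoOfRecord F N ν K k Ω).reg = regMSCoOfRecord F N ν K k Ω := rfl

/-- **THE BACKGROUND FIELD OF A SEQUENCE IN PRINT'S FULL CLASS, OF RECORD** — `U_k(s)(𝐖) = U_k(V)`, a MINIMAL CONFIGURATION of (5) on the space (6)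
`U_k({Ω_j(s)}, εreg) ∩ 𝔘(𝔅_k, 𝐖)` ([15]: «elements of the minimal orbit are called minimal configurations … denoted by U_k(V)»): r11's
`B14.Eq218Concrete.Ubg` at the datum `bgMSCoOfRecord … s.Ω`.  TOTAL (junk `1` off the solvable set, FILE 1 convention); existence of the minimal orbit
and its uniqueness as a critical orbit in (6) are [15] Thm 1 — NOT asserted.  Director-ym №149's `UbgMSOfRecord′`.
[cite: Balaban1985Variational, (5)–(6) p.278, Thm 1 (8) p.279; Balaban1988Convergent, (2.12)–(2.13) p.256–257, §2 p.258] -/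
def UbgMSCoOfRecord (ν : Stage7Numerics) (M : ℕ) (g : ℕ → ℝ) (K k : ℕ) (s : SeqOfRecord F ν M g K k) :
    MSField (F.P K) (SU N) → GaugeField (F.P K) 0 (SU N) :=
  B14.Eq218Concrete.Ubg (bgMSCoOfRecord F N ν K k s.Ω) k s

variable {F N}

/-- Unfolding to FILE 1's solution map on `𝔅({Ω_j(s)}) = genSet s.Ω k` in the full class (definitional). [cite: Balaban1988Convergent, (2.13) p.257] -/
theorem UbgMSCoOfRecord_apply (ν : Stage7Numerics) (M : ℕ) (g : ℕ → ℝ) (K k : ℕ) (s : SeqOfRecord F ν M g K k)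
    (W : MSField (F.P K) (SU N)) :
    UbgMSCoOfRecord F N ν M g K k s W = UminOfRecord (avOfRecord F N K) (regMSCoOfRecord F N ν K k s.Ω) (genSet s.Ω k) W := rfl

/-- It is r11's `Ubg` at the datum of record in the full class (definitional). [cite: Balaban1988Convergent, §2 p.258] -/
theorem UbgMSCoOfRecord_eq_Ubg (ν : Stage7Numerics) (M : ℕ) (g : ℕ → ℝ) (K k : ℕ) (s : SeqOfRecord F ν M g K k) :
    UbgMSCoOfRecord F N ν M g K k s = B14.Eq218Concrete.Ubg (bgMSCoOfRecord F N ν K k s.Ω) k s := rfl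

/-- **THE CHARACTERISING PROPERTY on the solvable set**: `U_k(s)(𝐖)` IS a minimal configuration of (5) on (6) for `𝔅({Ω_j(s)})` and `𝐖`.
[cite: Balaban1985Variational, (5)–(6) p.278; Balaban1988Convergent, (2.12) p.256] -/
theorem isMinimizer_UbgMSCoOfRecord (ν : Stage7Numerics) (M : ℕ) (g : ℕ → ℝ) (K k : ℕ) (s : SeqOfRecord F ν M g K k)
    {W : MSField (F.P K) (SU N)} (hW : W ∈ solvableDom (avOfRecord F N K) (regMSCoOfRecord F N ν K k s.Ω) (genSet s.Ω k)) :
    IsMinimizer (avOfRecord F N K) (regMSCoOfRecord F N ν K k s.Ω) (genSet s.Ω k) W (UbgMSCoOfRecord F N ν M g K k s W) :=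
  B14.Eq218Concrete.isMinimizer_Ubg (bgMSCoOfRecord F N ν K k s.Ω) k s hW

/-- The same characterising property with the class DISPLAYED as the explicit set of [15] (2) ∧ (6) (the shape node00-def-P11's class-(6) fact
`VariationalThm1RegSepCo6` quantifies over; definitional unfolding of `regMSCoOfRecord`). [cite: Balaban1985Variational, (2),(6) p.278 (bookkeeping)] -/
theorem isMinimizer_setOf_UbgMSCoOfRecord (ν : Stage7Numerics) (M : ℕ) (g : ℕ → ℝ) (K k : ℕ) (s : SeqOfRecord F ν M g K k)
    {W : MSField (F.P K) (SU N)} (hW : W ∈ solvableDom (avOfRecord F N K) (regMSCoOfRecord F N ν K k s.Ω) (genSet s.Ω k)) :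
    IsMinimizer (avOfRecord F N K)
      {U | (∀ j, j ≤ k → PlaqSmallOn (omegaPlaqs s.Ω j) (ν.εreg * (F.P K).eta j ^ 2) U) ∧ Sect2.CoDivClassOn s.Ω k ν.εreg U}
      (genSet s.Ω k) W (UbgMSCoOfRecord F N ν M g K k s W) :=
  isMinimizer_UbgMSCoOfRecord ν M g K k s hW

/-- The solvable set with the class displayed explicitly is the solvable set of record (definitional). [cite: Balaban1985Variational, (6),(8) p.278–279 (bookkeeping)] -/
theorem solvableDom_setOf_eq_regMSCo (ν : Stage7Numerics) (K k : ℕ) (Ω : ℕ → Set (Site (F.P K) 0)) :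
    solvableDom (avOfRecord F N K)
      {U | (∀ j, j ≤ k → PlaqSmallOn (omegaPlaqs Ω j) (ν.εreg * (F.P K).eta j ^ 2) U) ∧ Sect2.CoDivClassOn Ω k ν.εreg U} (genSet Ω k) =
      solvableDom (avOfRecord F N K) (regMSCoOfRecord F N ν K k Ω) (genSet Ω k) := rfl

/-- On the solvable set `U_k(s)(𝐖)` lies in print's full class `U_k({Ω_j(s)}, εreg)`. [cite: Balaban1985Variational, (2),(6) p.278] -/
theorem UbgMSCoOfRecord_mem_reg (ν : Stage7Numerics) (M : ℕ) (g : ℕ → ℝ) (K k : ℕ) (s : SeqOfRecord F ν M g K k)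
    {W : MSField (F.P K) (SU N)} (hW : W ∈ solvableDom (avOfRecord F N K) (regMSCoOfRecord F N ν K k s.Ω) (genSet s.Ω k)) :
    UbgMSCoOfRecord F N ν M g K k s W ∈ regMSCoOfRecord F N ν K k s.Ω :=
  (isMinimizer_UbgMSCoOfRecord ν M g K k s hW).1

/-- … hence in FILE 16's (1.7)-class ((1.7) at the minimiser). [cite: Balaban1985RegularSpaces, (1.7) p.77; Balaban1985Variational, (6) p.278] -/
theorem UbgMSCoOfRecord_mem_regMSOfRecord (ν : Stage7Numerics) (M : ℕ) (g : ℕ → ℝ) (K k : ℕ) (s : SeqOfRecord F ν M g K k)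
    {W : MSField (F.P K) (SU N)} (hW : W ∈ solvableDom (avOfRecord F N K) (regMSCoOfRecord F N ν K k s.Ω) (genSet s.Ω k)) :
    UbgMSCoOfRecord F N ν M g K k s W ∈ regMSOfRecord F N ν K k s.Ω :=
  (UbgMSCoOfRecord_mem_reg ν M g K k s hW).1

/-- **★ (1.9) AT THE MINIMISER, BY MEMBERSHIP** (director-ym №149 (5)): on the solvable set the background of record satisfies the co-divergence clauses of
its own class, `Sect2.CoDivClassOn s.Ω k εreg (U_k(s)(𝐖))` — the conjunct `Record13SepMixed` v1.3 carried as the guard `h9` on FILE 16's minimiser is here a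
PROPERTY of the object. [cite: Balaban1985RegularSpaces, (1.9) p.77; Balaban1985Variational, (2),(6) p.278] -/
theorem coDivClassOn_UbgMSCoOfRecord (ν : Stage7Numerics) (M : ℕ) (g : ℕ → ℝ) (K k : ℕ) (s : SeqOfRecord F ν M g K k)
    {W : MSField (F.P K) (SU N)} (hW : W ∈ solvableDom (avOfRecord F N K) (regMSCoOfRecord F N ν K k s.Ω) (genSet s.Ω k)) :
    Sect2.CoDivClassOn s.Ω k ν.εreg (UbgMSCoOfRecord F N ν M g K k s W) :=
  (UbgMSCoOfRecord_mem_reg ν M g K k s hW).2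

/-- On the solvable set the averages of `U_k(s)(𝐖)` agree with `𝐖` on the determining set: `M_𝔅(U_k(s)(𝐖)) = 𝐖` ([15] (3), [III] (2.11)–(2.12)).
[cite: Balaban1985Variational, (3) p.278; Balaban1988Convergent, (2.11)–(2.12) p.256] -/
theorem agreeOn_UbgMSCoOfRecord (ν : Stage7Numerics) (M : ℕ) (g : ℕ → ℝ) (K k : ℕ) (s : SeqOfRecord F ν M g K k)
    {W : MSField (F.P K) (SU N)} (hW : W ∈ solvableDom (avOfRecord F N K) (regMSCoOfRecord F N ν K k s.Ω) (genSet s.Ω k)) :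
    AgreeOn (genSet s.Ω k) (avgFamily (avOfRecord F N K) (UbgMSCoOfRecord F N ν M g K k s W)) W :=
  (isMinimizer_UbgMSCoOfRecord ν M g K k s hW).2.1

/-- On the solvable set `U_k(s)(𝐖)` minimises the Wilson action among the full-class configurations with the same averages (the third conjunct).
[cite: Balaban1985Variational, (5)–(6) p.278] -/
theorem wilsonAction4_UbgMSCoOfRecord_le (ν : Stage7Numerics) (M : ℕ) (g : ℕ → ℝ) (K k : ℕ) (s : SeqOfRecord F ν M g K k)
    {W : MSField (F.P K) (SU N)} (hW : W ∈ solvableDom (avOfRecord F N K) (regMSCoOfRecord F N ν K k s.Ω) (genSet s.Ω k))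
    {U : GaugeField (F.P K) 0 (SU N)} (hU : U ∈ regMSCoOfRecord F N ν K k s.Ω) (hUW : AgreeOn (genSet s.Ω k) (avgFamily (avOfRecord F N K) U) W) :
    wilsonAction4 (UbgMSCoOfRecord F N ν M g K k s W) ≤ wilsonAction4 U :=
  (isMinimizer_UbgMSCoOfRecord ν M g K k s hW).2.2 U hU hUW

/-- Off the solvable set `U_k(s)(𝐖)` is the unit configuration (documented junk default of FILE 1).
[cite: Balaban1988Convergent, (2.12) p.256 (typing convention)] -/
theorem UbgMSCoOfRecord_of_not_mem (ν : Stage7Numerics) (M : ℕ) (g : ℕ → ℝ) (K k : ℕ) (s : SeqOfRecord F ν M g K k)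
    {W : MSField (F.P K) (SU N)} (hW : W ∉ solvableDom (avOfRecord F N K) (regMSCoOfRecord F N ν K k s.Ω) (genSet s.Ω k)) :
    UbgMSCoOfRecord F N ν M g K k s W = fun _ => 1 :=
  UminOfRecord_of_not (avOfRecord F N K) (regMSCoOfRecord F N ν K k s.Ω) (by rwa [mem_solvableDom_iff] at hW)

/-- The same junk face with the unit written as `1`. [cite: Balaban1988Convergent, (2.12) p.256 (typing convention)] -/
theorem UbgMSCoOfRecord_eq_one_of_not_mem (ν : Stage7Numerics) (M : ℕ) (g : ℕ → ℝ) (K k : ℕ) (s : SeqOfRecord F ν M g K k)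
    {W : MSField (F.P K) (SU N)} (hW : W ∉ solvableDom (avOfRecord F N K) (regMSCoOfRecord F N ν K k s.Ω) (genSet s.Ω k)) :
    UbgMSCoOfRecord F N ν M g K k s W = 1 :=
  UbgMSCoOfRecord_of_not_mem ν M g K k s hW

/-- On the solvable set: (1.7) at the minimiser, scale `0` — `U_k(s)(𝐖)` is globally `εreg·η₀²`-small. [cite: Balaban1985RegularSpaces, (1.7) p.77 (j = 0); Balaban1985Variational, (6) p.278] -/
theorem plaqSmall_UbgMSCoOfRecord (ν : Stage7Numerics) (M : ℕ) (g : ℕ → ℝ) (K k : ℕ) (s : SeqOfRecord F ν M g K k)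
    {W : MSField (F.P K) (SU N)} (hW : W ∈ solvableDom (avOfRecord F N K) (regMSCoOfRecord F N ν K k s.Ω) (genSet s.Ω k)) :
    PlaqSmall (ν.εreg * (F.P K).eta 0 ^ 2) (UbgMSCoOfRecord F N ν M g K k s W) :=
  plaqSmall_of_mem_regMSCoOfRecord (UbgMSCoOfRecord_mem_reg ν M g K k s hW)

/-- On the solvable set: (1.7) at the minimiser, scale `1 ≤ j ≤ k` — the plaquettes meeting `Ω_j(s)` are `εreg·η_j²`-small.
[cite: Balaban1985RegularSpaces, (1.7) p.77; Balaban1985Variational, (6),(8) p.278–279] -/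
theorem plaqSmallOn_UbgMSCoOfRecord (ν : Stage7Numerics) (M : ℕ) (g : ℕ → ℝ) (K k : ℕ) (s : SeqOfRecord F ν M g K k)
    {W : MSField (F.P K) (SU N)} (hW : W ∈ solvableDom (avOfRecord F N K) (regMSCoOfRecord F N ν K k s.Ω) (genSet s.Ω k))
    {j : ℕ} (hj : 1 ≤ j) (hjk : j ≤ k) :
    PlaqSmallOn (B8Eq17ClassAkV1.plaqsOf (s.Ω j)) (ν.εreg * (F.P K).eta j ^ 2) (UbgMSCoOfRecord F N ν M g K k s W) :=
  plaqSmallOn_of_mem_regMSCoOfRecord (UbgMSCoOfRecord_mem_reg ν M g K k s hW) hj hjk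

/-- On the solvable set: (1.9) at the minimiser, scale `j ≤ k` — `‖η·(D^{η*}_U ∂U)(b)‖ < εreg·η_j³` on `Sect2.omegaBonds (s.Ω) j`.
[cite: Balaban1985RegularSpaces, (1.9) p.77; Balaban1985Variational, (2),(6) p.278] -/
theorem coDivSmallOn_UbgMSCoOfRecord (ν : Stage7Numerics) (M : ℕ) (g : ℕ → ℝ) (K k : ℕ) (s : SeqOfRecord F ν M g K k)
    {W : MSField (F.P K) (SU N)} (hW : W ∈ solvableDom (avOfRecord F N K) (regMSCoOfRecord F N ν K k s.Ω) (genSet s.Ω k))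
    {j : ℕ} (hjk : j ≤ k) :
    Sect2.CoDivSmallOn (Sect2.omegaBonds s.Ω j) (ν.εreg * (F.P K).eta j ^ 3) (UbgMSCoOfRecord F N ν M g K k s W) :=
  coDivClassOn_UbgMSCoOfRecord ν M g K k s hW j hjk

/-- On the solvable set: (1.9) at the minimiser on r12's `bondsOf (s.Ω j)`, `1 ≤ j ≤ k`. [cite: Balaban1985RegularSpaces, (1.9) p.77] -/
theorem coDivSmallOn_bondsOf_UbgMSCoOfRecord (ν : Stage7Numerics) (M : ℕ) (g : ℕ → ℝ) (K k : ℕ) (s : SeqOfRecord F ν M g K k)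
    {W : MSField (F.P K) (SU N)} (hW : W ∈ solvableDom (avOfRecord F N K) (regMSCoOfRecord F N ν K k s.Ω) (genSet s.Ω k))
    {j : ℕ} (hj : 1 ≤ j) (hjk : j ≤ k) :
    Sect2.CoDivSmallOn (bondsOf (s.Ω j)) (ν.εreg * (F.P K).eta j ^ 3) (UbgMSCoOfRecord F N ν M g K k s W) :=
  coDivSmallOn_bondsOf_of_mem_regMSCoOfRecord (UbgMSCoOfRecord_mem_reg ν M g K k s hW) hj hjk

/-! ## §3  The junction with FILE 16's (1.7)-only objects -/

/-- **A (1.7)-class minimiser that satisfies (1.9) IS a full-class minimiser** (node00-def-P11's `IsMinimizer.of_subset_of_mem` at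
`regMSCoOfRecord ⊆ regMSOfRecord`): how `Record13SepMixed` v1.3's guard `h9` on FILE 16's minimiser reads in this file's class.
[cite: Balaban1985Variational, (6) p.278; Balaban1988Convergent, (2.12) p.256] -/
theorem isMinimizer_regMSCo_of_isMinimizer_regMS (ν : Stage7Numerics) (K k : ℕ) (Ω : ℕ → Set (Site (F.P K) 0))
    {av : ∀ j, Averaging (F.P K) j (SU N)} {𝔹 : DetSet (F.P K)} {V : MSField (F.P K) (SU N)} {U₀ : GaugeField (F.P K) 0 (SU N)}
    (h : IsMinimizer av (regMSOfRecord F N ν K k Ω) 𝔹 V U₀) (h9 : Sect2.CoDivClassOn Ω k ν.εreg U₀) :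
    IsMinimizer av (regMSCoOfRecord F N ν K k Ω) 𝔹 V U₀ :=
  IsMinimizer.of_subset_of_mem (regMSCoOfRecord_subset_regMSOfRecord ν K k Ω) ⟨h.1, h9⟩ h

/-- Hence a datum solvable in the (1.7)-class whose FILE 16 background satisfies (1.9) is solvable in the full class (FILE 16's minimiser is a witness).
[cite: Balaban1985Variational, (6),(8) p.278–279; Balaban1988Convergent, (2.12) p.256] -/
theorem mem_solvableDom_regMSCo_of_coDiv (ν : Stage7Numerics) (M : ℕ) (g : ℕ → ℝ) (K k : ℕ) (s : SeqOfRecord F ν M g K k)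
    {W : MSField (F.P K) (SU N)} (hW : W ∈ solvableDom (avOfRecord F N K) (regMSOfRecord F N ν K k s.Ω) (genSet s.Ω k))
    (h9 : Sect2.CoDivClassOn s.Ω k ν.εreg (UbgMSOfRecord F N ν M g K k s W)) :
    W ∈ solvableDom (avOfRecord F N K) (regMSCoOfRecord F N ν K k s.Ω) (genSet s.Ω k) :=
  ⟨UbgMSOfRecord F N ν M g K k s W, isMinimizer_regMSCo_of_isMinimizer_regMS ν K k s.Ω (isMinimizer_UbgMSOfRecord ν M g K k s hW) h9⟩

/-- … and FILE 16's background itself is then a minimal configuration over the full class (the two chosen orbit elements `UbgMSOfRecord … W` and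
`UbgMSCoOfRecord … W` are NOT identified — both minimise (5) on (6); equality mod gauge is [15] Thm 1's uniqueness, never asserted).
[cite: Balaban1985Variational, (6) p.278, Thm 1 p.279; Balaban1988Convergent, (2.12) p.256] -/
theorem isMinimizer_regMSCo_UbgMSOfRecord_of_coDiv (ν : Stage7Numerics) (M : ℕ) (g : ℕ → ℝ) (K k : ℕ) (s : SeqOfRecord F ν M g K k)
    {W : MSField (F.P K) (SU N)} (hW : W ∈ solvableDom (avOfRecord F N K) (regMSOfRecord F N ν K k s.Ω) (genSet s.Ω k))
    (h9 : Sect2.CoDivClassOn s.Ω k ν.εreg (UbgMSOfRecord F N ν M g K k s W)) :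
    IsMinimizer (avOfRecord F N K) (regMSCoOfRecord F N ν K k s.Ω) (genSet s.Ω k) W (UbgMSOfRecord F N ν M g K k s W) :=
  isMinimizer_regMSCo_of_isMinimizer_regMS ν K k s.Ω (isMinimizer_UbgMSOfRecord ν M g K k s hW) h9

/-- The two minimal configurations have THE SAME Wilson action (both minimise (5) over the full class with the same averages), whenever FILE 16's
background satisfies (1.9). [cite: Balaban1985Variational, (5)–(6) p.278 (bookkeeping)] -/
theorem wilsonAction4_UbgMSCoOfRecord_eq_of_coDiv (ν : Stage7Numerics) (M : ℕ) (g : ℕ → ℝ) (K k : ℕ) (s : SeqOfRecord F ν M g K k)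
    {W : MSField (F.P K) (SU N)} (hW : W ∈ solvableDom (avOfRecord F N K) (regMSOfRecord F N ν K k s.Ω) (genSet s.Ω k))
    (h9 : Sect2.CoDivClassOn s.Ω k ν.εreg (UbgMSOfRecord F N ν M g K k s W)) :
    wilsonAction4 (UbgMSCoOfRecord F N ν M g K k s W) = wilsonAction4 (UbgMSOfRecord F N ν M g K k s W) := by
  have hCo := mem_solvableDom_regMSCo_of_coDiv ν M g K k s hW h9
  have h₁ := isMinimizer_regMSCo_UbgMSOfRecord_of_coDiv ν M g K k s hW h9
  have h₂ := isMinimizer_UbgMSCoOfRecord ν M g K k s hCo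
  exact le_antisymm (h₂.2.2 _ h₁.1 h₁.2.1) (h₁.2.2 _ h₂.1 h₂.2.1)

/-- **The `Γ₀` clause for the full class** (FILE 16 §4 pattern): solvability at positive length forces on `W₀` the scale-`0` plaquette bound `εreg·η₀²`
(print's `ε₀` of [15] (6)) at the plaquettes with three corners in `Ω₁ᶜ` — there a minimiser EQUALS `W₀` (`M⁰ = id` on `Γ₀`, FILE 16
`eq_W0_of_isMinimizer_genSet`). [cite: Balaban1985RegularSpaces, (1.7) p.77 (j = 0); Balaban1985Variational, (6)–(8) p.278–279; Balaban1988Convergent, (2.10)–(2.12) p.256] -/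
theorem dist1_W0_lt_of_mem_solvableDom_regMSCo (ν : Stage7Numerics) {K k : ℕ} (hk : 0 < k) (Ω : ℕ → Set (Site (F.P K) 0))
    {W : MSField (F.P K) (SU N)} (hW : W ∈ solvableDom (avOfRecord F N K) (regMSCoOfRecord F N ν K k Ω) (genSet Ω k))
    (p : Plaq (F.P K) 0) (h₁ : p.src ∉ Ω 1) (h₂ : p.src.shift p.μ ∉ Ω 1) (h₃ : p.src.shift p.ν ∉ Ω 1) :
    dist1 (GaugeField.plaqHol (W 0) p) < ν.εreg * (F.P K).eta 0 ^ 2 := by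
  obtain ⟨U₀, hU₀⟩ := hW
  have hb := eq_W0_of_isMinimizer_genSet (avOfRecord F N K) (regMSCoOfRecord F N ν K k Ω) hk Ω hU₀
  have hhol : GaugeField.plaqHol U₀ p = GaugeField.plaqHol (W 0) p :=
    plaqHol_eq_of_bond_eq p (hb _ h₁) (hb _ h₂) (hb _ h₃) (hb _ h₁)
  rw [← hhol]
  exact plaqSmall_of_mem_regMSCoOfRecord hU₀.1 p

/-- The solvable set of the full class lies inside the set of data whose `W₀` passes the `Γ₀` plaquette test — equivalently: a datum failing it is NOT
solvable in the full class either (contrapositive bookkeeping of the previous face). [cite: Balaban1988Convergent, (2.10)–(2.12) p.256 (bookkeeping)] -/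
theorem not_mem_solvableDom_regMSCo_of_le_plaq (ν : Stage7Numerics) {K k : ℕ} (hk : 0 < k) (Ω : ℕ → Set (Site (F.P K) 0))
    (W : MSField (F.P K) (SU N)) (p : Plaq (F.P K) 0)
    (h₁ : p.src ∉ Ω 1) (h₂ : p.src.shift p.μ ∉ Ω 1) (h₃ : p.src.shift p.ν ∉ Ω 1)
    (hp : ν.εreg * (F.P K).eta 0 ^ 2 ≤ dist1 (GaugeField.plaqHol (W 0) p)) :
    W ∉ solvableDom (avOfRecord F N K) (regMSCoOfRecord F N ν K k Ω) (genSet Ω k) := fun hW =>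
  absurd (dist1_W0_lt_of_mem_solvableDom_regMSCo ν hk Ω hW p h₁ h₂ h₃) (not_lt.mpr hp)

end Literature.MathematicalPhysics.QuantumFieldTheory.Balaban1983to89.Node00
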